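import Literature.MathematicalPhysics.QuantumFieldTheory.Balaban1983to89.B9Thm312WholeStepRegular
import Literature.MathematicalPhysics.QuantumFieldTheory.Balaban1983to89.B9Thm312WholeStepDirFrom3131
import Literature.MathematicalPhysics.QuantumFieldTheory.Balaban1983to89.B9SmoothHolderClassState

/-!
# `Balaban1983to89.B9Thm312WholeStepDirRegular` — [B9] Theorem 3.12 (3.130)∕(3.138): THE ONE-STEP LEFT-FORM MEMBERS OF ROWS 20–21 OVER A REGULAR
# STATE CLASS — ∇_UG₀T, ∇_{U,ν}G₀T, Φ^Y_β∇_UG₀T, Φ^X_β∇_{U,ν}G₀T, Φ^X_βG₀T for T ∈ {Δ′_π, Δ′_π + Δ⁽²⁾_π} OUT OF A FREE BLOCK NORM 𝔖 (the fields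
# `LeftStep.stepD ∕ stepD1` and `StepDir.sDd ∕ sDd1 ∕ pY ∕ pY1 ∕ pXd ∕ pXd1 ∕ pX ∕ pX1` with the raw state 𝔠⁽ᵖ⁾ replaced by 𝔖), from the (3.131)∕(3.137)
# letters out of 𝔖 (`LettersS3131`) and Theorem 3.3's members of G₀, by one [4]-(2.54) composition per summand

T. Bałaban, *Propagators for lattice gauge theories in a background field*, Commun. Math. Phys. **99** (1985) 389–434 [`Balaban1985BackgroundPropagators`,
"B9"]; [4] = T. Bałaban, *Propagators and renormalization transformations for lattice gauge theories. II*, Commun. Math. Phys. **96** (1984) 223–250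
[`Balaban1984PropagatorsII`].  statement-level skeleton of published theorems with citation tags; proofs where landed; nothing here is a claim about the
Yang–Mills mass gap.  Sequel of `B9Thm312WholeStepRegular` (`StepS`, `LettersS3131`, dag-n06-l g26) and of `B9Thm312WholeLeftStepFrom3131` ∕
`B9Thm312WholeStepDirFrom3131` (the same members out of the raw class 𝔠⁽ᵖ⁾, g11–g12).

THE PRINT.  p. 422: *"This inequality and Theorem 3.3 for G₀ imply a convergence of the series (3.130), for α₀ sufficiently small, in all norms appearing on
the left-hand sides of the inequalities (3.42)–(3.47)"*; p. 423: *"G₁ = Σ G₀((Δ′_π + Δ⁽²⁾_π)G₀)ⁿ (3.138) … we have derivatives in the operator Δ′_π + Δ⁽²⁾_π which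
have to be applied either to the operator on the right, or on the left, because kernels of the operators defining Δ′_π + Δ⁽²⁾_π are not regular enough"*;
Thm 3.3 p. 399; (3.42)–(3.45) pp. 397–398; (3.39) p. 397 (*"max_{μ,ν}"*); [4] (2.54) p. 233 and Lemma 2.1 (2.61) p. 234.

THE POINT (dag-n06-l LOCATED-U8 ∕ U8′, `U8S-PROGRAMME-MEMO.md`).  Every `…1` one-step field of the rows-20∕21 schemas (`Step.step1`, `LeftStep.stepD1`,
`StepDir.pY1 ∕ pX1 ∕ sDd1 ∕ pXd1`) has the RAW sup class 𝔠⁽ᵖ⁾ as its source with T₂ = Δ⁽²⁾_π un-sandwiched on it — beyond print at Δ⁽²⁾ ≠ 0 (the right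
factor 1 − D_UG′RD\*_U of (3.135) is an order-zero singular-integral word on a raw input).  Print's induction carries the regularity of the G₀-outputs:
on a state class 𝔖 with the (3.44) member of D_UG′D\*_U the one-sided letters T_a₂ : 𝔖 → 𝔠⁽⁰⁾, T_b₂ : 𝔖 → bH ARE printed species
(`B9PerturbationMajorant2Letters`, `B9Thm313WholeDelta2LettersAtStatePrint`).  `B9Thm312WholeStepRegular` re-typed the STEP G₀T : 𝔖 → 𝔖; THIS FILE
re-types the five LEFT-FORM ONE-STEP MEMBER FAMILIES E∘G₀∘T OUT OF 𝔖 (E ∈ {∇_U, ∇_{U,ν}, Φ^Y_β∇_U, Φ^X_β∇_{U,ν}, Φ^X_β}), the objects the first resolvent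
form E∘A∘F = E∘G₀∘F + (E∘G₀∘T)(A∘F) of the members of A = G, G₁ consumes (sequel `B9Thm312WholeMembersRegular`):
* §1 ★ `hasMaj_comp_splitS` — GENERIC: for a split T = T_a + D_U·T_b with T_a : 𝔖 → b₀ and T_b : 𝔖 → bH (t·e^{−δ_T d}) and a left factor E∘G₀ : b₀ → b_out
  (a·e^{−δ₀d}), E∘G₀∘D_U : bH → b_out (a_D·e^{−δ₃d}): E∘G₀∘T : 𝔖 → b_out with (κ₀·a + κ_H·a_D)·t·c·e^{−ρd} (0 ≦ ρ ≦ δ_T, ρ + σ ≦ min(δ₀, δ₃));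
  ★ `hasMaj_comp_splitS_pair` — the same for T = Δ′_π AND T = Δ′_π + Δ⁽²⁾_π at once (`LettersS3131`), both below θ·e^{−δ_K d} for θ ≧ 2(κ₀a + κ_Ha_D)tc, δ_K ≦ ρ;
* §2 the named families, each for BOTH perturbations: ★ `stepDS_of_lettersS` (∇_UG₀T : 𝔖 → 𝔠_Y⁽¹⁾ from (3.42)₂ `he1` and the mixed member ∇_UG₀D_U out of bH),
  ★ `stepDdS_of_lettersS` (∇_{U,ν}G₀T : 𝔖 → 𝔠⁽¹⁾ from `e1d` and ∇_{U,ν}G₀D_U out of bH), ★ `probeYS_of_lettersS` (Φ^Y_β∇_UG₀T : 𝔖 → 𝔠_{PY}^{(β−1)} from (3.43)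
  `h43L` and the (3.45)-type mixed probe `pYDH`), ★ `probeXdS_of_lettersS` (Φ^X_β∇_{U,ν}G₀T from `h43d` and `pXdDH`), ★ `probeXS_of_lettersS` (Φ^X_βG₀T :
  𝔖 → 𝔠_{PX}^{(β−2)} from the zeroth-order probe `pX0` and the probe of the mixed member Φ^X_βG₀D_U out of bH at weight (β−2)).
* §3 THE TWO STATES 𝔖₂ = (Lʲη)⁻¹·𝔖₁ (`weightNorm 𝔖₁ (rwt (−1))`, the g26 pin) and 𝔖₁ (dimension 1, where the right entries G₀∇\*, G₀∇\*_μ live), related by [4] (2.60):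
  `loc_state_up ∕ _down`, ★ `stepS_up` (the step at 𝔖₂ IS the step at 𝔖₁ with θ·L, rate −αδ), ★ `fieldS_up ∕ fieldS_up_weight` (a member out of 𝔖₂ is a member out of 𝔖₁ one
  dimension up), `readS_up` (the sup reading), `entryS_down` (an entry 𝔠_V^{(t)} → 𝔖₁ is the entry 𝔠_V^{(t−1)} → 𝔖₂).
The Hölder class bH of the T_b letters is FREE: the Hölder pin for the ∇∕Φ∇ members ((3.44)∕(3.45)-type mixed entries), the sup class 𝔠_W for
the Φ^X_β member ((3.43) for G₀D_U needs only |T_bf|) — two instances of ONE schema `LettersS3131` at the knit.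
HONEST SCOPE.  Bookkeeping over free block maps, free letters and a free state class; every G₀ member and every letter enters as a HYPOTHESIS of
printed type; nothing of [B9]∕[4] asserted; no pin, no certificate edit; COUNT-NEUTRAL; N06 NOT discharged; one finite lattice at a time — nothing
continuum ∕ OS ∕ mass gap.  Cell `pub-ymgap` (HUMAN RULING D-0062), Track A node N06 [B9], bundle F7 rows 20–21, seat `pub-ymgap-dag-n06-l` (g27),
2026-08-29.  NEW file; nothing landed is modified.
-/

namespace Literature.MathematicalPhysics.QuantumFieldTheory.Balaban1983to89.B9Thm312WholeStepDirRegular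

open Literature.MathematicalPhysics.QuantumFieldTheory.Balaban1983to89
open Finset B6RandomWalk B6RandomWalkHom B9Thm34Ext B11SectG B9SectDSup B9Thm312Whole B9Thm312WholeLeaf B9Thm312WholeClasses
open B9RWSums343Holder B9RWSums343to347Whole B9RWSums346Schur B9Thm312WholeDir B9Thm313WholeHolder B9Thm313WholeDir
open B9Thm312WholeStepFrom3131 B9Thm312WholeLeftStepFrom3131 B9Thm312WholeStepDirFrom3131 B9Thm312WholeStepRegular
open B9SmoothHolderClassState B9PerturbationMajorantAlgebra

noncomputable section

variable {g : B9.Geometry} {B : B9.Backgrounds} {X Y Z W PX PY P : Type}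
variable [Fintype X] [Fintype Y] [Fintype Z] [Fintype W] [Fintype PX] [Fintype PY] [Fintype P] [Fintype g.Site]
variable {R₀ : ℝ} {H₀ : Prop}

/-! ## §1 The generic left-form member over a free state class -/

omit [Fintype X] [Fintype Y] [Fintype Z] [Fintype W] [Fintype PX] [Fintype PY] [Fintype P] [Fintype g.Site] in
/-- Kernel monotonicity: C·e^{−rd} ≦ θ·e^{−δ_K d} for 0 ≦ C ≦ θ, δ_K ≦ r, d ≧ 0. [folklore] -/
private theorem kernel_leS {C θ r δK d : ℝ} (hC : 0 ≤ C) (hCθ : C ≤ θ) (hδK : δK ≤ r) (hd : 0 ≤ d) :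
    C * Real.exp (-(r * d)) ≤ θ * Real.exp (-(δK * d)) :=
  calc C * Real.exp (-(r * d)) ≤ C * Real.exp (-(δK * d)) :=
      mul_le_mul_of_nonneg_left (Real.exp_le_exp.mpr (neg_le_neg (mul_le_mul_of_nonneg_right hδK hd))) hC
    _ ≤ θ * Real.exp (-(δK * d)) := mul_le_mul_of_nonneg_right hCθ (Real.exp_nonneg _)

omit [Fintype X] [Fintype Y] [Fintype Z] [Fintype W] [Fintype PX] [Fintype PY] [Fintype P] in
/-- ★ **THE GENERIC LEFT-FORM MEMBER E∘G₀∘T OVER A FREE STATE CLASS, FOR A SPLIT PERTURBATION T = T_a + D_U·T_b** ([4] (2.54) twice and Lemma 2.1 (2.61) at the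
margin σ): if the left factor E∘G₀ maps a class `b₀` (cutting cost κ₀) into `bout` with a·e^{−δ₀d} and E∘G₀∘D_U maps `bH` (cost κ_H) into `bout` with
a_D·e^{−δ₃d}, while T_a : 𝔖 → b₀ and T_b : 𝔖 → bH have the small majorants t·e^{−δ_T d}, then E∘G₀∘T = (E∘G₀)T_a + (E∘G₀D_U)T_b maps 𝔖 into `bout` with
(κ₀·a + κ_H·a_D)·t·c·e^{−ρd} for every 0 ≦ ρ ≦ δ_T with ρ + σ ≦ min(δ₀, δ₃).  `B9Thm312WholeStepDirFrom3131.probeStep_of_split` is the case 𝔖 = 𝔠^{(−2)},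
b₀ = 𝔠⁽⁰⁾; `B9Thm312WholeStepRegular.hasMaj_G0_comp_splitS` the case E = 1, bout = 𝔖.
[cite: Balaban1985BackgroundPropagators, (3.130)–(3.131) pp.421–422 + (3.137)–(3.138) p.423 + (3.42)–(3.45) pp.397–398; Balaban1984PropagatorsII, (2.52)–(2.56) pp.232–233 + Lemma 2.1 (2.61) p.234] -/
theorem hasMaj_comp_splitS (hG : GeoOK g) {F : Type} [AddCommGroup F] [Module ℝ F]
    {b₀ 𝔖 : BlockNorm (toB6 g R₀ H₀) (X → ℝ)} {bH : BlockNorm (toB6 g R₀ H₀) (W → ℝ)} {bout : BlockNorm (toB6 g R₀ H₀) F}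
    {EG : (X → ℝ) →ₗ[ℝ] F} {T Ta : Module.End ℝ (X → ℝ)} {Dv : (W → ℝ) →ₗ[ℝ] (X → ℝ)} {Tb : (X → ℝ) →ₗ[ℝ] (W → ℝ)}
    {a aD t δ₀ δ₃ δT ρ σ c : ℝ} (hrow : RowSum (toB6 g R₀ H₀) σ c)
    (ha : 0 ≤ a) (haD : 0 ≤ aD) (ht : 0 ≤ t) (hρ : 0 ≤ ρ) (hρT : ρ ≤ δT) (hρ₀ : ρ + σ ≤ δ₀) (hρ₃ : ρ + σ ≤ δ₃)
    (hsplit : T = Ta + Dv ∘ₗ Tb)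
    (hE : HasMaj b₀ bout EG (fun a' b => a * Real.exp (-(δ₀ * g.dist a' b))))
    (hED : HasMaj bH bout (EG ∘ₗ Dv) (fun a' b => aD * Real.exp (-(δ₃ * g.dist a' b))))
    (hta : HasMaj 𝔖 b₀ Ta (fun a' b => t * Real.exp (-(δT * g.dist a' b))))
    (htb : HasMaj 𝔖 bH Tb (fun a' b => t * Real.exp (-(δT * g.dist a' b)))) :
    HasMaj 𝔖 bout (EG ∘ₗ T) (fun a' b => (b₀.κ * a + bH.κ * aD) * t * c * Real.exp (-(ρ * g.dist a' b))) := by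
  have htri : Triangle254 (toB6 g R₀ H₀) := fun a b c => hG.tri a b c
  have h1 := hasMaj_comp_exp htri hG.dnn hrow ha ht hρ hρT hρ₀ hE hta
  have h2 := hasMaj_comp_exp htri hG.dnn hrow haD ht hρ hρT hρ₃ hED htb
  refine ((h1.add h2).congr fun μ => ?_).mono fun a' b => le_of_eq ?_
  · rw [hsplit]
    simp only [LinearMap.add_apply, LinearMap.comp_apply, map_add]
  · simp only [toB6_dist]
    ring

omit [Fintype X] [Fintype Y] [Fintype Z] [Fintype W] [Fintype PX] [Fintype PY] [Fintype P] in
/-- ★ **BOTH PERTURBATIONS AT ONCE**: for T = Δ′_π = T_a + D_U·T_b and T₁ = Δ′_π + Δ⁽²⁾_π = (T_a + T_a₂) + D_U·(T_b + T_b₂) with all four letters out of 𝔖 below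
t·e^{−δ_T d} (the fields of `LettersS3131 𝔬 … 𝔖 bH t δT U`), the left-form members E∘G₀∘Δ′_π and E∘G₀∘(Δ′_π + Δ⁽²⁾_π) out of 𝔖 are both below θ·e^{−δ_K d}
for every θ ≧ 2(κ₀·a + κ_H·a_D)·t·c and δ_K ≦ ρ (0 ≦ ρ ≦ δ_T, ρ + σ ≦ min(δ₀, δ₃)) — print's pattern on p. 423 with each Δ providing the small t = O(1)·Mα₀.
[cite: Balaban1985BackgroundPropagators, Thm 3.12 p.423 + (3.130)–(3.131) pp.421–422 + (3.137)–(3.138) p.423; Balaban1984PropagatorsII, (2.54) p.233 + Lemma 2.1 (2.61) p.234] -/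
theorem hasMaj_comp_splitS_pair (hG : GeoOK g) {F : Type} [AddCommGroup F] [Module ℝ F] {𝔬 : Ops g B X Y Z W}
    {Ta Ta₂ : B.Cfg → Module.End ℝ (X → ℝ)} {Tb Tb₂ : B.Cfg → (X → ℝ) →ₗ[ℝ] (W → ℝ)}
    {b₀ 𝔖 : BlockNorm (toB6 g R₀ H₀) (X → ℝ)} {bH : BlockNorm (toB6 g R₀ H₀) (W → ℝ)} {bout : BlockNorm (toB6 g R₀ H₀) F}
    {EG : (X → ℝ) →ₗ[ℝ] F} {U : B.Cfg} {a aD t δ₀ δ₃ δT ρ σ c θ δK : ℝ} (hrow : RowSum (toB6 g R₀ H₀) σ c) (hc : 0 ≤ c)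
    (ha : 0 ≤ a) (haD : 0 ≤ aD) (ht : 0 ≤ t) (hρ : 0 ≤ ρ) (hρT : ρ ≤ δT) (hρ₀ : ρ + σ ≤ δ₀) (hρ₃ : ρ + σ ≤ δ₃)
    (hθ : 2 * ((b₀.κ * a + bH.κ * aD) * t * c) ≤ θ) (hδK : δK ≤ ρ)
    (hE : HasMaj b₀ bout EG (fun a' b => a * Real.exp (-(δ₀ * g.dist a' b))))
    (hED : HasMaj bH bout (EG ∘ₗ 𝔬.Dv U) (fun a' b => aD * Real.exp (-(δ₃ * g.dist a' b))))
    (hsplit : 𝔬.Tpi U = Ta U + 𝔬.Dv U ∘ₗ Tb U) (hsplit₂ : 𝔬.T2 U = Ta₂ U + 𝔬.Dv U ∘ₗ Tb₂ U)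
    (hta : HasMaj 𝔖 b₀ (Ta U) (fun a' b => t * Real.exp (-(δT * g.dist a' b))))
    (hta₂ : HasMaj 𝔖 b₀ (Ta₂ U) (fun a' b => t * Real.exp (-(δT * g.dist a' b))))
    (htb : HasMaj 𝔖 bH (Tb U) (fun a' b => t * Real.exp (-(δT * g.dist a' b))))
    (htb₂ : HasMaj 𝔖 bH (Tb₂ U) (fun a' b => t * Real.exp (-(δT * g.dist a' b)))) :
    HasMaj 𝔖 bout (EG ∘ₗ 𝔬.Tpi U) (fun a' b => θ * Real.exp (-(δK * g.dist a' b))) ∧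
      HasMaj 𝔖 bout (EG ∘ₗ (𝔬.Tpi U + 𝔬.T2 U)) (fun a' b => θ * Real.exp (-(δK * g.dist a' b))) := by
  have hA := hasMaj_comp_splitS hG hrow ha haD ht hρ hρT hρ₀ hρ₃ hsplit hE hED hta htb
  have hB := hasMaj_comp_splitS hG hrow ha haD ht hρ hρT hρ₀ hρ₃ hsplit₂ hE hED hta₂ htb₂
  have hK : 0 ≤ (b₀.κ * a + bH.κ * aD) * t * c :=
    mul_nonneg (mul_nonneg (add_nonneg (mul_nonneg b₀.κ_nonneg ha) (mul_nonneg bH.κ_nonneg haD)) ht) hc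
  have hc1 : (b₀.κ * a + bH.κ * aD) * t * c ≤ θ := by linarith
  refine ⟨hA.mono fun a' b => kernel_leS hK hc1 hδK (hG.dnn a' b), ((hA.add hB).congr fun μ => ?_).mono fun a' b => ?_⟩
  · simp only [LinearMap.add_apply, LinearMap.comp_apply, map_add]
  · calc (b₀.κ * a + bH.κ * aD) * t * c * Real.exp (-(ρ * g.dist a' b)) + (b₀.κ * a + bH.κ * aD) * t * c * Real.exp (-(ρ * g.dist a' b))
        = 2 * ((b₀.κ * a + bH.κ * aD) * t * c) * Real.exp (-(ρ * g.dist a' b)) := by ring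
      _ ≤ θ * Real.exp (-(δK * g.dist a' b)) := kernel_leS (mul_nonneg (by norm_num) hK) hθ hδK (hG.dnn a' b)

omit [Fintype Y] [Fintype Z] [Fintype W] [Fintype PX] [Fintype PY] [Fintype P] in
/-- **BOTH PERTURBATIONS AT ONCE, FROM THE LETTER SCHEMA `LettersS3131`** (`hasMaj_comp_splitS_pair` with the splits and the four letters read off the schema; b₀ = 𝔠⁽⁰⁾,
κ₀ = 1). [cite: Balaban1985BackgroundPropagators, Thm 3.12 p.423 + (3.130)–(3.131) pp.421–422 + (3.137)–(3.138) p.423; Balaban1984PropagatorsII, (2.54) p.233 + Lemma 2.1 (2.61) p.234] -/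
theorem hasMaj_comp_lettersS_pair (hG : GeoOK g) {F : Type} [AddCommGroup F] [Module ℝ F] {𝔬 : Ops g B X Y Z W}
    {Ta Ta₂ : B.Cfg → Module.End ℝ (X → ℝ)} {Tb Tb₂ : B.Cfg → (X → ℝ) →ₗ[ℝ] (W → ℝ)}
    {𝔖 : BlockNorm (toB6 g R₀ H₀) (X → ℝ)} {bH : BlockNorm (toB6 g R₀ H₀) (W → ℝ)} {bout : BlockNorm (toB6 g R₀ H₀) F}
    {EG : (X → ℝ) →ₗ[ℝ] F} {U : B.Cfg} {a aD t δ₀ δ₃ δT ρ σ c θ δK : ℝ} (hrow : RowSum (toB6 g R₀ H₀) σ c) (hc : 0 ≤ c)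
    (ha : 0 ≤ a) (haD : 0 ≤ aD) (ht : 0 ≤ t) (hρ : 0 ≤ ρ) (hρT : ρ ≤ δT) (hρ₀ : ρ + σ ≤ δ₀) (hρ₃ : ρ + σ ≤ δ₃)
    (hθ : 2 * ((a + bH.κ * aD) * t * c) ≤ θ) (hδK : δK ≤ ρ)
    (hE : HasMaj (cNorm R₀ H₀ 𝔬.blk hG.lenle 0) bout EG (fun a' b => a * Real.exp (-(δ₀ * g.dist a' b))))
    (hED : HasMaj bH bout (EG ∘ₗ 𝔬.Dv U) (fun a' b => aD * Real.exp (-(δ₃ * g.dist a' b))))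
    (hL : LettersS3131 𝔬 Ta Ta₂ Tb Tb₂ R₀ H₀ hG.lenle 𝔖 bH t δT U) :
    HasMaj 𝔖 bout (EG ∘ₗ 𝔬.Tpi U) (fun a' b => θ * Real.exp (-(δK * g.dist a' b))) ∧
      HasMaj 𝔖 bout (EG ∘ₗ (𝔬.Tpi U + 𝔬.T2 U)) (fun a' b => θ * Real.exp (-(δK * g.dist a' b))) := by
  have hθ' : 2 * (((cNorm R₀ H₀ 𝔬.blk hG.lenle 0 (X := X)).κ * a + bH.κ * aD) * t * c) ≤ θ := by
    simpa only [cNorm_κ, one_mul] using hθ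
  exact hasMaj_comp_splitS_pair hG hrow hc ha haD ht hρ hρT hρ₀ hρ₃ hθ' hδK hE hED hL.split hL.split₂ hL.ta hL.ta₂ hL.tbH hL.tb₂H

omit [Fintype Y] [Fintype Z] [Fintype W] [Fintype PX] [Fintype PY] [Fintype P] in
/-- Source side: a majorant out of 𝔠^{(0)} (real weight (Lʲη)⁰) is the same majorant out of 𝔠⁽⁰⁾ (integer weight). [cite: Balaban1985BackgroundPropagators, (3.42) p.397 (bookkeeping)] -/
theorem hasMaj_src_zero_ofR (hG : GeoOK g) {F : Type} [AddCommGroup F] [Module ℝ F] {blk : X → g.Site}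
    {b₂ : BlockNorm (toB6 g R₀ H₀) F} {T : (X → ℝ) →ₗ[ℝ] F} {K : g.Site → g.Site → ℝ}
    (h : HasMaj (cNormR R₀ H₀ blk hG.lenle 0) b₂ T K) : HasMaj (cNorm R₀ H₀ blk hG.lenle 0) b₂ T K := by
  intro y' μ hμ y
  have hb := h y' μ hμ y
  rw [cNormR_loc blk hG.lenle (0 : ℝ) y' μ, Real.rpow_zero, one_mul] at hb
  rw [show (cNorm R₀ H₀ blk hG.lenle 0).loc y' μ = (BlockNorm.ofBlocks (toB6 g R₀ H₀) blk).loc y' μ from by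
    simp only [cNorm, weightNorm_loc, wt, pow_zero, inv_one, one_mul]]
  exact hb

/-! ## §2 The five named member families of rows 20–21 out of the state class -/

omit [Fintype Z] [Fintype W] [Fintype PX] [Fintype PY] [Fintype P] in
/-- ★ **THE LEFT STEP ∇_UG₀T OUT OF THE STATE CLASS** (the fields `LeftStep.stepD ∕ stepD1` with 𝔠⁽²⁾ ↦ 𝔖): from Theorem 3.3's (3.42)₂ member `he1` (∇_UG₀ :
𝔠⁽⁰⁾ → 𝔠_Y⁽¹⁾, `hasMaj_DG0_cNorm`), the mixed member ∇_UG₀D_U : bH → 𝔠_Y⁽¹⁾ ((3.44) for G₀ out of the Hölder class the T_b letters land in — `Letters313D.dgDH`'s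
shape) and `LettersS3131`: ∇_UG₀Δ′_π and ∇_UG₀(Δ′_π + Δ⁽²⁾_π) map 𝔖 into 𝔠_Y⁽¹⁾ below θ·e^{−δ_K d} for θ ≧ 2(B₀ + κ_H·B₃)·t·c, δ_K ≦ ρ.
[cite: Balaban1985BackgroundPropagators, Thm 3.12 p.423 + Thm 3.3 p.399 + (3.42)–(3.44) pp.397–398 + (3.130)–(3.131) pp.421–422 + (3.137)–(3.138) p.423; Balaban1984PropagatorsII, (2.54) p.233 + Lemma 2.1 (2.61) p.234] -/
theorem stepDS_of_lettersS (hG : GeoOK g) {𝔬 : Ops g B X Y Z W} {Ta Ta₂ : B.Cfg → Module.End ℝ (X → ℝ)}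
    {Tb Tb₂ : B.Cfg → (X → ℝ) →ₗ[ℝ] (W → ℝ)} {𝔖 : BlockNorm (toB6 g R₀ H₀) (X → ℝ)} {bH : BlockNorm (toB6 g R₀ H₀) (W → ℝ)} {U : B.Cfg}
    {B₀ B₃ t δ₀ δ₃ δT ρ σ c θ δK : ℝ}
    (hrow : RowSum (toB6 g R₀ H₀) σ c) (hc : 0 ≤ c) (hB₀ : 0 ≤ B₀) (hB₃ : 0 ≤ B₃) (ht : 0 ≤ t) (hρ : 0 ≤ ρ) (hρT : ρ ≤ δT)
    (hρ₀ : ρ + σ ≤ δ₀) (hρ₃ : ρ + σ ≤ δ₃) (hθ : 2 * ((B₀ + bH.κ * B₃) * t * c) ≤ θ) (hδK : δK ≤ ρ)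
    (he1 : HasMajorantHom (g := toB6 g R₀ H₀) 𝔬.blk 𝔬.blkY (𝔬.D U ∘ₗ 𝔬.G0 U)
      (fun (a b : g.Site) => B₀ * g.len a * Real.exp (-(δ₀ * g.dist a b))))
    (hdgDH : HasMaj bH (cNorm R₀ H₀ 𝔬.blkY hG.lenle 1) (𝔬.D U ∘ₗ 𝔬.G0 U ∘ₗ 𝔬.Dv U)
      (fun a b => B₃ * Real.exp (-(δ₃ * g.dist a b))))
    (hL : LettersS3131 𝔬 Ta Ta₂ Tb Tb₂ R₀ H₀ hG.lenle 𝔖 bH t δT U) :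
    HasMaj 𝔖 (cNorm R₀ H₀ 𝔬.blkY hG.lenle 1) (𝔬.D U ∘ₗ 𝔬.G0 U ∘ₗ 𝔬.Tpi U) (fun a b => θ * Real.exp (-(δK * g.dist a b))) ∧
      HasMaj 𝔖 (cNorm R₀ H₀ 𝔬.blkY hG.lenle 1) (𝔬.D U ∘ₗ 𝔬.G0 U ∘ₗ (𝔬.Tpi U + 𝔬.T2 U))
        (fun a b => θ * Real.exp (-(δK * g.dist a b))) := by
  have hD0 := hasMaj_DG0_cNorm (R₀ := R₀) (H₀ := H₀) hG hB₀ he1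
  obtain ⟨hA, hB⟩ := hasMaj_comp_lettersS_pair hG (EG := 𝔬.D U ∘ₗ 𝔬.G0 U) hrow hc hB₀ hB₃ ht hρ hρT hρ₀ hρ₃ hθ hδK hD0 hdgDH hL
  exact ⟨hA.congr fun μ => by simp only [LinearMap.comp_apply], hB.congr fun μ => by simp only [LinearMap.comp_apply]⟩

omit [Fintype Y] [Fintype Z] [Fintype W] [Fintype PX] [Fintype PY] [Fintype P] in
/-- ★ **THE DERIVATIVE OF THE STEP THROUGH EVERY COMPONENT, OUT OF THE STATE CLASS** (the fields `StepDir.sDd ν ∕ sDd1 ν` with 𝔠⁽²⁾ ↦ 𝔖): from (3.42)₂ for the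
component ∇_{U,ν}G₀ (`Thm33G0Dir.e1d`'s shape), the mixed member ∇_{U,ν}G₀D_U out of bH (`Letters313DM.dgDHd`'s shape) and `LettersS3131`: ∇_{U,ν}G₀Δ′_π and
∇_{U,ν}G₀(Δ′_π + Δ⁽²⁾_π) map 𝔖 into 𝔠⁽¹⁾ below θ_D·e^{−δ_K d} for θ_D ≧ 2(B₀ + κ_H·B₃)·t·c, δ_K ≦ ρ.
[cite: Balaban1985BackgroundPropagators, Thm 3.12 p.423 + Thm 3.3 p.399 + (3.42)–(3.44) pp.397–398 + (3.39) p.397 + (3.130)–(3.131) pp.421–422 + (3.137)–(3.138) p.423; Balaban1984PropagatorsII, (2.54) p.233 + Lemma 2.1 (2.61) p.234] -/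
theorem stepDdS_of_lettersS (hG : GeoOK g) {𝔬 : Ops g B X Y Z W} {Dd : B.Cfg → P → Module.End ℝ (X → ℝ)}
    {Ta Ta₂ : B.Cfg → Module.End ℝ (X → ℝ)} {Tb Tb₂ : B.Cfg → (X → ℝ) →ₗ[ℝ] (W → ℝ)}
    {𝔖 : BlockNorm (toB6 g R₀ H₀) (X → ℝ)} {bH : BlockNorm (toB6 g R₀ H₀) (W → ℝ)} {U : B.Cfg} {B₀ B₃ t δ₀ δ₃ δT ρ σ c θD δK : ℝ}
    (hrow : RowSum (toB6 g R₀ H₀) σ c) (hc : 0 ≤ c) (hB₀ : 0 ≤ B₀) (hB₃ : 0 ≤ B₃) (ht : 0 ≤ t) (hρ : 0 ≤ ρ) (hρT : ρ ≤ δT)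
    (hρ₀ : ρ + σ ≤ δ₀) (hρ₃ : ρ + σ ≤ δ₃) (hθD : 2 * ((B₀ + bH.κ * B₃) * t * c) ≤ θD) (hδK : δK ≤ ρ)
    (he1d : ∀ ν : P, HasMajorantHom (g := toB6 g R₀ H₀) 𝔬.blk 𝔬.blk (Dd U ν ∘ₗ 𝔬.G0 U)
      (fun (a b : g.Site) => B₀ * g.len a * Real.exp (-(δ₀ * g.dist a b))))
    (hdgDHd : ∀ ν : P, HasMaj bH (cNorm R₀ H₀ 𝔬.blk hG.lenle 1) (Dd U ν ∘ₗ 𝔬.G0 U ∘ₗ 𝔬.Dv U)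
      (fun a b => B₃ * Real.exp (-(δ₃ * g.dist a b))))
    (hL : LettersS3131 𝔬 Ta Ta₂ Tb Tb₂ R₀ H₀ hG.lenle 𝔖 bH t δT U) (ν : P) :
    HasMaj 𝔖 (cNorm R₀ H₀ 𝔬.blk hG.lenle 1) (Dd U ν ∘ₗ 𝔬.G0 U ∘ₗ 𝔬.Tpi U) (fun a b => θD * Real.exp (-(δK * g.dist a b))) ∧
      HasMaj 𝔖 (cNorm R₀ H₀ 𝔬.blk hG.lenle 1) (Dd U ν ∘ₗ 𝔬.G0 U ∘ₗ (𝔬.Tpi U + 𝔬.T2 U))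
        (fun a b => θD * Real.exp (-(δK * g.dist a b))) := by
  have hD0 := hasMaj_DG0_cNorm (R₀ := R₀) (H₀ := H₀) hG hB₀ (he1d ν)
  obtain ⟨hA, hB⟩ := hasMaj_comp_lettersS_pair hG (EG := Dd U ν ∘ₗ 𝔬.G0 U) hrow hc hB₀ hB₃ ht hρ hρT hρ₀ hρ₃ hθD hδK hD0 (hdgDHd ν) hL
  exact ⟨hA.congr fun μ => by simp only [LinearMap.comp_apply], hB.congr fun μ => by simp only [LinearMap.comp_apply]⟩

omit [Fintype Y] [Fintype Z] [Fintype W] [Fintype PX] [Fintype P] in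
/-- ★ **THE Φ^Y_β-PROBE OF THE LEFT STEP OUT OF THE STATE CLASS** (the fields `StepDir.pY β ∕ pY1 β` with 𝔠^{(−2)} ↦ 𝔖): from Theorem 3.3's (3.43) member `h43L`
(Φ^Y_β∇_UG₀ : 𝔠⁽⁰⁾ → 𝔠_{PY}^{(β−1)}, `hasMaj_probe_cNormR_of_hom`), the (3.45)-type mixed probe Φ^Y_β∇_UG₀D_U out of bH (`Letters313H.pYDH`'s shape) and `LettersS3131`:
Φ^Y_β∇_UG₀Δ′_π and Φ^Y_β∇_UG₀(Δ′_π + Δ⁽²⁾_π) map 𝔖 into 𝔠_{PY}^{(β−1)} below θ_H·e^{−δ_K d} for θ_H ≧ 2(B_h + κ_H·B_hD)·t·c, δ_K ≦ ρ (per β; print's B₀(β)).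
[cite: Balaban1985BackgroundPropagators, Thm 3.12 p.423 + Thm 3.3 p.399 + (3.43)–(3.45) p.398 + (3.130)–(3.131) pp.421–422 + (3.137)–(3.138) p.423; Balaban1984PropagatorsII, (2.54) p.233 + Lemma 2.1 (2.61) p.234] -/
theorem probeYS_of_lettersS (hG : GeoOK g) {𝔬 : Ops g B X Y Z W} {𝔭 : HolderProbes g B X Y PX PY}
    {Ta Ta₂ : B.Cfg → Module.End ℝ (X → ℝ)} {Tb Tb₂ : B.Cfg → (X → ℝ) →ₗ[ℝ] (W → ℝ)}
    {𝔖 : BlockNorm (toB6 g R₀ H₀) (X → ℝ)} {bH : BlockNorm (toB6 g R₀ H₀) (W → ℝ)} {U : B.Cfg} {β Bh BhD t δ₀ δ₃ δT ρ σ c θH δK : ℝ}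
    (hrow : RowSum (toB6 g R₀ H₀) σ c) (hc : 0 ≤ c) (hBh : 0 ≤ Bh) (hBhD : 0 ≤ BhD) (ht : 0 ≤ t) (hρ : 0 ≤ ρ) (hρT : ρ ≤ δT)
    (hρ₀ : ρ + σ ≤ δ₀) (hρ₃ : ρ + σ ≤ δ₃) (hθH : 2 * ((Bh + bH.κ * BhD) * t * c) ≤ θH) (hδK : δK ≤ ρ)
    (h43L : HasMajorantHom (g := toB6 g R₀ H₀) 𝔬.blk 𝔭.blkPY (𝔭.ΦY U β ∘ₗ (𝔬.D U ∘ₗ 𝔬.G0 U))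
      (fun (a b : g.Site) => Bh * g.len a ^ (1 - β) * Real.exp (-(δ₀ * g.dist a b))))
    (hpYDH : HasMaj bH (cNormR R₀ H₀ 𝔭.blkPY hG.lenle (β - 1)) ((𝔭.ΦY U β ∘ₗ 𝔬.D U ∘ₗ 𝔬.G0 U) ∘ₗ 𝔬.Dv U)
      (fun a b => BhD * Real.exp (-(δ₃ * g.dist a b))))
    (hL : LettersS3131 𝔬 Ta Ta₂ Tb Tb₂ R₀ H₀ hG.lenle 𝔖 bH t δT U) :
    HasMaj 𝔖 (cNormR R₀ H₀ 𝔭.blkPY hG.lenle (β - 1)) ((𝔭.ΦY U β ∘ₗ 𝔬.D U ∘ₗ 𝔬.G0 U) ∘ₗ 𝔬.Tpi U)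
        (fun a b => θH * Real.exp (-(δK * g.dist a b))) ∧
      HasMaj 𝔖 (cNormR R₀ H₀ 𝔭.blkPY hG.lenle (β - 1)) ((𝔭.ΦY U β ∘ₗ 𝔬.D U ∘ₗ 𝔬.G0 U) ∘ₗ (𝔬.Tpi U + 𝔬.T2 U))
        (fun a b => θH * Real.exp (-(δK * g.dist a b))) := by
  have hE := hasMaj_src_zero_ofR hG (hasMaj_probe_cNormR_of_hom hG hBh h43L)
  exact hasMaj_comp_lettersS_pair hG (EG := 𝔭.ΦY U β ∘ₗ 𝔬.D U ∘ₗ 𝔬.G0 U) hrow hc hBh hBhD ht hρ hρT hρ₀ hρ₃ hθH hδK hE hpYDH hL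

omit [Fintype Y] [Fintype Z] [Fintype W] [Fintype PY] [Fintype P] in
/-- ★ **THE Φ^X_β-PROBE OF THE STEP'S COMPONENT DERIVATIVES OUT OF THE STATE CLASS** (the fields `StepDir.pXd ν β ∕ pXd1 ν β` with 𝔠^{(−2)} ↦ 𝔖): from (3.43) for the
component (`Thm33G0Dir.h43d`: Φ^X_β∇_{U,ν}G₀), the mixed probe Φ^X_β∇_{U,ν}G₀D_U out of bH (`Thm33G0DirX.pXdDH`'s shape) and `LettersS3131`: Φ^X_β∇_{U,ν}G₀Δ′_π and
Φ^X_β∇_{U,ν}G₀(Δ′_π + Δ⁽²⁾_π) map 𝔖 into 𝔠_{PX}^{(β−1)} below θ_H·e^{−δ_K d} for θ_H ≧ 2(B_h + κ_H·B_dX)·t·c, δ_K ≦ ρ.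
[cite: Balaban1985BackgroundPropagators, Thm 3.12 p.423 + Thm 3.3 p.399 + (3.43)–(3.45) p.398 + (3.39) p.397 + (3.130)–(3.131) pp.421–422 + (3.137)–(3.138) p.423; Balaban1984PropagatorsII, (2.54) p.233 + Lemma 2.1 (2.61) p.234] -/
theorem probeXdS_of_lettersS (hG : GeoOK g) {𝔬 : Ops g B X Y Z W} {𝔭 : HolderProbes g B X Y PX PY} {Dd : B.Cfg → P → Module.End ℝ (X → ℝ)}
    {Ta Ta₂ : B.Cfg → Module.End ℝ (X → ℝ)} {Tb Tb₂ : B.Cfg → (X → ℝ) →ₗ[ℝ] (W → ℝ)}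
    {𝔖 : BlockNorm (toB6 g R₀ H₀) (X → ℝ)} {bH : BlockNorm (toB6 g R₀ H₀) (W → ℝ)} {U : B.Cfg} {β Bh BdX t δ₀ δ₃ δT ρ σ c θH δK : ℝ}
    (hrow : RowSum (toB6 g R₀ H₀) σ c) (hc : 0 ≤ c) (hBh : 0 ≤ Bh) (hBdX : 0 ≤ BdX) (ht : 0 ≤ t) (hρ : 0 ≤ ρ) (hρT : ρ ≤ δT)
    (hρ₀ : ρ + σ ≤ δ₀) (hρ₃ : ρ + σ ≤ δ₃) (hθH : 2 * ((Bh + bH.κ * BdX) * t * c) ≤ θH) (hδK : δK ≤ ρ) (ν : P)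
    (h43d : HasMajorantHom (g := toB6 g R₀ H₀) 𝔬.blk 𝔭.blkPX (𝔭.ΦX U β ∘ₗ (Dd U ν ∘ₗ 𝔬.G0 U))
      (fun (a b : g.Site) => Bh * g.len a ^ (1 - β) * Real.exp (-(δ₀ * g.dist a b))))
    (hpXdDH : HasMaj bH (cNormR R₀ H₀ 𝔭.blkPX hG.lenle (β - 1)) ((𝔭.ΦX U β ∘ₗ Dd U ν ∘ₗ 𝔬.G0 U) ∘ₗ 𝔬.Dv U)
      (fun a b => BdX * Real.exp (-(δ₃ * g.dist a b))))
    (hL : LettersS3131 𝔬 Ta Ta₂ Tb Tb₂ R₀ H₀ hG.lenle 𝔖 bH t δT U) :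
    HasMaj 𝔖 (cNormR R₀ H₀ 𝔭.blkPX hG.lenle (β - 1)) ((𝔭.ΦX U β ∘ₗ Dd U ν ∘ₗ 𝔬.G0 U) ∘ₗ 𝔬.Tpi U)
        (fun a b => θH * Real.exp (-(δK * g.dist a b))) ∧
      HasMaj 𝔖 (cNormR R₀ H₀ 𝔭.blkPX hG.lenle (β - 1)) ((𝔭.ΦX U β ∘ₗ Dd U ν ∘ₗ 𝔬.G0 U) ∘ₗ (𝔬.Tpi U + 𝔬.T2 U))
        (fun a b => θH * Real.exp (-(δK * g.dist a b))) := by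
  have hE := hasMaj_src_zero_ofR hG (hasMaj_probe_cNormR_of_hom hG hBh h43d)
  exact hasMaj_comp_lettersS_pair hG (EG := 𝔭.ΦX U β ∘ₗ Dd U ν ∘ₗ 𝔬.G0 U) hrow hc hBh hBdX ht hρ hρT hρ₀ hρ₃ hθH hδK hE hpXdDH hL

omit [Fintype Y] [Fintype Z] [Fintype W] [Fintype PY] [Fintype P] in
/-- ★ **THE Φ^X_β-PROBE OF THE STEP ITSELF OUT OF THE STATE CLASS, AT DIMENSION 2** (the fields `StepDir.pX β ∕ pX1 β` re-typed: source 𝔖, target 𝔠_{PX}^{(β−2)} — the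
probe class of a dimension-2 output, no scale transfer): from the zeroth-order probe Φ^X_β∘G₀ : 𝔠⁽⁰⁾ → 𝔠_{PX}^{(β−2)} (`Thm33G0DirX.pX0`'s shape), the probe of the
mixed member Φ^X_βG₀D_U out of bH INTO 𝔠_{PX}^{(β−2)} (a_D·e^{−δ₃d}; at the knit `Letters313H.pXDv` transferred by one power and precomposed with bH's sup
reading — (3.43) for G₀D_U needs only |T_bf|) and `LettersS3131`: Φ^X_βG₀Δ′_π and Φ^X_βG₀(Δ′_π + Δ⁽²⁾_π) map 𝔖 into 𝔠_{PX}^{(β−2)} below θ_H·e^{−δ_K d} for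
θ_H ≧ 2(B_x0 + κ_H·a_D)·t·c, δ_K ≦ ρ.
[cite: Balaban1985BackgroundPropagators, Thm 3.12 p.423 + Thm 3.3 p.399 + (3.42)–(3.43) pp.397–398 + p.398 (remark after (3.47)) + (3.130)–(3.131) pp.421–422 + (3.138) p.423; Balaban1984PropagatorsII, (2.54) p.233 + Lemma 2.1 (2.60)–(2.61) p.234] -/
theorem probeXS_of_lettersS (hG : GeoOK g) {𝔬 : Ops g B X Y Z W} {𝔭 : HolderProbes g B X Y PX PY}
    {Ta Ta₂ : B.Cfg → Module.End ℝ (X → ℝ)} {Tb Tb₂ : B.Cfg → (X → ℝ) →ₗ[ℝ] (W → ℝ)}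
    {𝔖 : BlockNorm (toB6 g R₀ H₀) (X → ℝ)} {bH : BlockNorm (toB6 g R₀ H₀) (W → ℝ)} {U : B.Cfg} {β Bx0 aD t δ₀ δ₃ δT ρ σ c θH δK : ℝ}
    (hrow : RowSum (toB6 g R₀ H₀) σ c) (hc : 0 ≤ c) (hBx0 : 0 ≤ Bx0) (haD : 0 ≤ aD) (ht : 0 ≤ t) (hρ : 0 ≤ ρ) (hρT : ρ ≤ δT)
    (hρ₀ : ρ + σ ≤ δ₀) (hρ₃ : ρ + σ ≤ δ₃) (hθH : 2 * ((Bx0 + bH.κ * aD) * t * c) ≤ θH) (hδK : δK ≤ ρ)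
    (hpX0 : HasMaj (cNormR R₀ H₀ 𝔬.blk hG.lenle 0) (cNormR R₀ H₀ 𝔭.blkPX hG.lenle (β - 2)) (𝔭.ΦX U β ∘ₗ 𝔬.G0 U)
      (fun a b => Bx0 * Real.exp (-(δ₀ * g.dist a b))))
    (hpXDv : HasMaj bH (cNormR R₀ H₀ 𝔭.blkPX hG.lenle (β - 2)) ((𝔭.ΦX U β ∘ₗ 𝔬.G0 U) ∘ₗ 𝔬.Dv U)
      (fun a b => aD * Real.exp (-(δ₃ * g.dist a b))))
    (hL : LettersS3131 𝔬 Ta Ta₂ Tb Tb₂ R₀ H₀ hG.lenle 𝔖 bH t δT U) :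
    HasMaj 𝔖 (cNormR R₀ H₀ 𝔭.blkPX hG.lenle (β - 2)) ((𝔭.ΦX U β ∘ₗ 𝔬.G0 U) ∘ₗ 𝔬.Tpi U)
        (fun a b => θH * Real.exp (-(δK * g.dist a b))) ∧
      HasMaj 𝔖 (cNormR R₀ H₀ 𝔭.blkPX hG.lenle (β - 2)) ((𝔭.ΦX U β ∘ₗ 𝔬.G0 U) ∘ₗ (𝔬.Tpi U + 𝔬.T2 U))
        (fun a b => θH * Real.exp (-(δK * g.dist a b))) := by
  have hE := hasMaj_src_zero_ofR hG hpX0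
  exact hasMaj_comp_lettersS_pair hG (EG := 𝔭.ΦX U β ∘ₗ 𝔬.G0 U) hrow hc hBx0 haD ht hρ hρT hρ₀ hρ₃ hθH hδK hE hpXDv hL

/-! ## §3 The two states: (Lʲη)⁻¹·𝔖₁ = 𝔖₂ and back ([4] (2.60)) -/

section States

variable {F₁ F₂ : Type} [AddCommGroup F₁] [Module ℝ F₁] [AddCommGroup F₂] [Module ℝ F₂]

omit [Fintype X] [Fintype Y] [Fintype Z] [Fintype W] [Fintype PX] [Fintype PY] [Fintype P] in
/-- `(Lʲη)·((Lʲη)⁻¹·𝔖₁)` has the local sizes of `𝔖₁` (lengths positive). [cite: Balaban1985BackgroundPropagators, (3.41) p.397 (bookkeeping)] -/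
theorem loc_state_up (hG : GeoOK g) (𝔖₁ : BlockNorm (toB6 g R₀ H₀) F₁) (y : g.Site) (f : F₁) :
    (weightNorm (weightNorm 𝔖₁ (rwt g (-1)) (rwt_nonneg hG.lenle (-1))) (rwt g 1) (rwt_nonneg hG.lenle 1)).loc y f = 𝔖₁.loc y f := by
  simp only [weightNorm_loc, rwt, Real.rpow_one, Real.rpow_neg_one]
  rw [← mul_assoc, mul_inv_cancel₀ (hG.lenpos y).ne', one_mul]

omit [Fintype X] [Fintype Y] [Fintype Z] [Fintype W] [Fintype PX] [Fintype PY] [Fintype P] in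
/-- `(Lʲη)⁻¹·((Lʲη)·𝔖)` has the local sizes of `𝔖`. [cite: Balaban1985BackgroundPropagators, (3.41) p.397 (bookkeeping)] -/
theorem loc_state_down (hG : GeoOK g) (𝔖 : BlockNorm (toB6 g R₀ H₀) F₁) (y : g.Site) (f : F₁) :
    (weightNorm (weightNorm 𝔖 (rwt g 1) (rwt_nonneg hG.lenle 1)) (rwt g (-1)) (rwt_nonneg hG.lenle (-1))).loc y f = 𝔖.loc y f := by
  simp only [weightNorm_loc, rwt, Real.rpow_one, Real.rpow_neg_one]
  rw [← mul_assoc, inv_mul_cancel₀ (hG.lenpos y).ne', one_mul]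

omit [Fintype X] [Fintype Y] [Fintype Z] [Fintype W] [Fintype PX] [Fintype PY] [Fintype P] in
/-- ★ **THE STEP AT 𝔖₂ IS THE STEP AT 𝔖₁**: `G₀T : (Lʲη)⁻¹·𝔖₁ → (Lʲη)⁻¹·𝔖₁` with θ·e^{−δ_K d} gives `G₀T : 𝔖₁ → 𝔖₁` with θ·L·e^{−(δ_K−αδ)d}` ([4] (2.60) at γ = 1 under the member
facts `Facts347`). [cite: Balaban1985BackgroundPropagators, (3.130) p.421 + p.398 (remark after (3.47)); Balaban1984PropagatorsII, Lemma 2.1 (2.60) p.234] -/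
theorem stepS_up (hG : GeoOK g) {dF : ℕ} {δ α L₀ : ℝ} (hF : Facts347 g R₀ H₀ dF δ α L₀) {𝔖₁ : BlockNorm (toB6 g R₀ H₀) (X → ℝ)}
    {K : Module.End ℝ (X → ℝ)} {θ δK : ℝ} (hθ : 0 ≤ θ)
    (h : HasMaj (weightNorm 𝔖₁ (rwt g (-1)) (rwt_nonneg hG.lenle (-1))) (weightNorm 𝔖₁ (rwt g (-1)) (rwt_nonneg hG.lenle (-1))) K
      (fun a b => θ * Real.exp (-(δK * g.dist a b)))) :
    HasMaj 𝔖₁ 𝔖₁ K (fun a b => θ * g.L * Real.exp (-((δK - α * δ) * g.dist a b))) := by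
  have h1 := hasMaj_rescale hG hF (1 : ℝ) (by norm_num) hθ h
  rw [rpow_abs_eq_pow g.L 1 1 (by norm_num), pow_one] at h1
  exact hasMaj_congr_src (fun y f => (loc_state_up hG 𝔖₁ y f).symm) (fun _ _ hl => hl)
    (hasMaj_congr_tgt (fun y f => (loc_state_up hG 𝔖₁ y f).symm) h1)

omit [Fintype X] [Fintype Y] [Fintype Z] [Fintype W] [Fintype PX] [Fintype PY] [Fintype P] in
/-- ★ **A LEFT-FORM MEMBER OUT OF 𝔖₂ IS A MEMBER OUT OF 𝔖₁, ONE DIMENSION UP**: `E : (Lʲη)⁻¹·𝔖₁ → 𝔠_V^{(s)}` with C·e^{−rd} gives `E : 𝔖₁ → 𝔠_V^{(s+1)}` with C·L·e^{−(r−αδ)d}.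
[cite: Balaban1985BackgroundPropagators, p.398 (remark after (3.47)); Balaban1984PropagatorsII, Lemma 2.1 (2.60) p.234] -/
theorem fieldS_up (hG : GeoOK g) {dF : ℕ} {δ α L₀ : ℝ} (hF : Facts347 g R₀ H₀ dF δ α L₀) {V : Type} [Fintype V] {blkV : V → g.Site}
    {𝔖₁ : BlockNorm (toB6 g R₀ H₀) (X → ℝ)} {E : (X → ℝ) →ₗ[ℝ] (V → ℝ)} {C r s : ℝ} (hC : 0 ≤ C)
    (h : HasMaj (weightNorm 𝔖₁ (rwt g (-1)) (rwt_nonneg hG.lenle (-1))) (cNormR R₀ H₀ blkV hG.lenle s) E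
      (fun a b => C * Real.exp (-(r * g.dist a b)))) :
    HasMaj 𝔖₁ (cNormR R₀ H₀ blkV hG.lenle (s + 1)) E (fun a b => C * g.L * Real.exp (-((r - α * δ) * g.dist a b))) := by
  have h1 := hasMaj_rescale_tgt_cNormR hG hF (1 : ℝ) (by norm_num) hC h
  rw [rpow_abs_eq_pow g.L 1 1 (by norm_num), pow_one] at h1
  exact hasMaj_congr_src (fun y f => (loc_state_up hG 𝔖₁ y f).symm) (fun _ _ hl => hl) h1

omit [Fintype X] [Fintype Y] [Fintype Z] [Fintype W] [Fintype PX] [Fintype PY] [Fintype P] in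
/-- **A LEFT-FORM MEMBER OUT OF 𝔖₂ INTO ANY CLASS IS A MEMBER OUT OF 𝔖₁ INTO THE RESCALED CLASS**: `E : (Lʲη)⁻¹·𝔖₁ → b₂` with C·e^{−rd} gives `E : 𝔖₁ → (Lʲη)·b₂` with
C·L·e^{−(r−αδ)d} (for Hölder targets). [cite: Balaban1985BackgroundPropagators, p.398 (remark after (3.47)); Balaban1984PropagatorsII, Lemma 2.1 (2.60) p.234] -/
theorem fieldS_up_weight (hG : GeoOK g) {dF : ℕ} {δ α L₀ : ℝ} (hF : Facts347 g R₀ H₀ dF δ α L₀)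
    {𝔖₁ : BlockNorm (toB6 g R₀ H₀) (X → ℝ)} {b₂ : BlockNorm (toB6 g R₀ H₀) F₂} {E : (X → ℝ) →ₗ[ℝ] F₂} {C r : ℝ} (hC : 0 ≤ C)
    (h : HasMaj (weightNorm 𝔖₁ (rwt g (-1)) (rwt_nonneg hG.lenle (-1))) b₂ E (fun a b => C * Real.exp (-(r * g.dist a b)))) :
    HasMaj 𝔖₁ (weightNorm b₂ (rwt g 1) (rwt_nonneg hG.lenle 1)) E (fun a b => C * g.L * Real.exp (-((r - α * δ) * g.dist a b))) := by
  have h1 := hasMaj_rescale hG hF (1 : ℝ) (by norm_num) hC h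
  rw [rpow_abs_eq_pow g.L 1 1 (by norm_num), pow_one] at h1
  exact hasMaj_congr_src (fun y f => (loc_state_up hG 𝔖₁ y f).symm) (fun _ _ hl => hl) h1

omit [Fintype X] [Fintype Y] [Fintype Z] [Fintype W] [Fintype PX] [Fintype PY] [Fintype P] in
/-- **AN ENTRY INTO 𝔖₁ IS AN ENTRY INTO 𝔖₂, ONE DIMENSION DOWN ON THE SOURCE**: `F : 𝔠_V^{(t)} → 𝔖₁` with C·e^{−rd} gives `F : 𝔠_V^{(t−1)} → (Lʲη)⁻¹·𝔖₁` with C·L·e^{−(r−αδ)d}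
(how a dimension-1 producer — G₀∇\*, G₀∇\*_μ, G₀D_U — enters the dimension-2 state). [cite: Balaban1985BackgroundPropagators, p.398 (remark after (3.47)); Balaban1984PropagatorsII, Lemma 2.1 (2.60) p.234] -/
theorem entryS_down (hG : GeoOK g) {dF : ℕ} {δ α L₀ : ℝ} (hF : Facts347 g R₀ H₀ dF δ α L₀) {V : Type} [Fintype V] {blkV : V → g.Site}
    {𝔖₁ : BlockNorm (toB6 g R₀ H₀) (X → ℝ)} {Fop : (V → ℝ) →ₗ[ℝ] (X → ℝ)} {C r t : ℝ} (hC : 0 ≤ C)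
    (h : HasMaj (cNormR R₀ H₀ blkV hG.lenle t) 𝔖₁ Fop (fun a b => C * Real.exp (-(r * g.dist a b)))) :
    HasMaj (cNormR R₀ H₀ blkV hG.lenle (t + -1)) (weightNorm 𝔖₁ (rwt g (-1)) (rwt_nonneg hG.lenle (-1))) Fop
      (fun a b => C * g.L * Real.exp (-((r - α * δ) * g.dist a b))) := by
  have h1 := hasMaj_rescale_src_cNormR hG hF (-1 : ℝ) (by norm_num) hC h
  rwa [rpow_abs_eq_pow g.L (-1) 1 (by norm_num), pow_one] at h1

omit [Fintype Y] [Fintype Z] [Fintype W] [Fintype PX] [Fintype PY] [Fintype P] in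
/-- **THE SUP READING AT DIMENSION 1 FROM THE SUP READING AT DIMENSION 2**: `id : (Lʲη)⁻¹·𝔖₁ → 𝔠^{(−2)}` (C·e^{−rd}) gives `id : 𝔖₁ → 𝔠^{(−1)}` (C·L·e^{−(r−αδ)d}).
[cite: Balaban1985BackgroundPropagators, (3.42) p.397 + p.398 (remark after (3.47)); Balaban1984PropagatorsII, Lemma 2.1 (2.60) p.234] -/
theorem readS_up (hG : GeoOK g) {dF : ℕ} {δ α L₀ : ℝ} (hF : Facts347 g R₀ H₀ dF δ α L₀) {blk : X → g.Site}
    {𝔖₁ : BlockNorm (toB6 g R₀ H₀) (X → ℝ)} {C r : ℝ} (hC : 0 ≤ C)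
    (h : HasMaj (weightNorm 𝔖₁ (rwt g (-1)) (rwt_nonneg hG.lenle (-1))) (cNormR R₀ H₀ blk hG.lenle (-2)) LinearMap.id
      (fun a b => C * Real.exp (-(r * g.dist a b)))) :
    HasMaj 𝔖₁ (cNormR R₀ H₀ blk hG.lenle (-1)) LinearMap.id (fun a b => C * g.L * Real.exp (-((r - α * δ) * g.dist a b))) := by
  have h1 := fieldS_up hG hF hC h
  rwa [show (-2 : ℝ) + 1 = -1 by norm_num] at h1

end States

end

end Literature.MathematicalPhysics.QuantumFieldTheory.Balaban1983to89.B9Thm312WholeStepDirRegular
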